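import Literature.NumberTheory.EllipticCurves.ShintaniSchwartzFourier
import Mathlib.Analysis.Complex.UpperHalfPlane.MoebiusAction
import HarnessLib

/-!
# `SL₂(ℝ)`-equivariance of Shintani's Schwartz function: `f_w(x ∘ g) = (cw + d)² f_{g·w}(x)`

A small algebraic brick for the unfolding of Shintani's theta lift (Shintani 1975, (2.12); the
tree's `ShintaniSchwartzFourier` proves the special case `g = g_w`, `g_w · i = w`, as
`Shintani.shintaniFn_eq_mLin`). For a real binary quadratic form `x = [x₀, x₁, x₂]`
(`Shintani.V`) and `g = (a b; c d) ∈ SL₂(ℝ)` let `x ∘ g` be the form `(X, Y) ↦ x(aX + bY, cX + dY)`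
(`compSL g x`, coefficients `[x₀a² + x₁ac + x₂c², 2x₀ab + x₁(ad+bc) + 2x₂cd, x₀b² + x₁bd + x₂d²]`).
We PROVE, for `τ ∈ ℍ`:

* `disc_compSL` — `disc (x ∘ g) = disc x`;
* `formEval_compSL` — `(x ∘ g)(τ, 1) = (cτ + d)² · x(g·τ, 1)`;
* `pw_compSL` — `p_τ(x ∘ g) = p_{g·τ}(x)` (the majorant is transported: the negative line at `g·τ`
  pulls back to the negative line at `τ`), hence `majorant_compSL`;
* `shintaniFn_compSL` — **`f_{τ,z}(x ∘ g) = (cτ + d)² · f_{g·τ,z}(x)`**: the kernel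
  `Θ(z, ·) = ∑_x ω(x) f_{·,z}(x)` has weight `-2` in the second variable as soon as `ω` is
  `Γ`-invariant, so that `φ(w) Θ(z, w)` is `Γ`-invariant for `φ` of weight `2`, and an orbit integral
  `∫ φ(w) f_{w,z}(x) dμ(w)` becomes `∫ (φ|₂g)(w) f_{w,z}(x ∘ g) dμ(w)` under `w ↦ g·w` — the reduction of
  every orbit to a standard form (`√Δ·XY`, `λ(X² + Y²)`, `λY²`) used with `ShintaniOrbitIntegrals`.
* `compSL_mul` — `x ∘ (g h) = (x ∘ g) ∘ h` (a right action), `compSL_one`.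

No named facts; the only definition is `compSL`.

## References

* T. Shintani, *On construction of holomorphic cusp forms of half integral weight*, Nagoya Math. J.
  58 (1975) 83–126, §2, (2.12). [Shintani1975]
-/

noncomputable section

open Complex
open scoped MatrixGroups

namespace Literature.NumberTheory.EllipticCurves.Shintani

open UpperHalfPlane hiding I

/-- The right action of `SL₂(ℝ)` on real binary quadratic forms: `(x ∘ g)(X, Y) = x(aX + bY, cX + dY)`
for `g = (a b; c d)`, on coefficient vectors `[x₀, x₁, x₂]`. [cite: Shintani1975, §2] -/
def compSL (g : SL(2, ℝ)) (x : V) : V :=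
  !₂[x 0 * g 0 0 ^ 2 + x 1 * g 0 0 * g 1 0 + x 2 * g 1 0 ^ 2,
    2 * x 0 * g 0 0 * g 0 1 + x 1 * (g 0 0 * g 1 1 + g 0 1 * g 1 0) + 2 * x 2 * g 1 0 * g 1 1,
    x 0 * g 0 1 ^ 2 + x 1 * g 0 1 * g 1 1 + x 2 * g 1 1 ^ 2]

/-- `(x ∘ g)₀ = x₀a² + x₁ac + x₂c²`. [folklore] -/
@[simp] theorem compSL_apply_zero (g : SL(2, ℝ)) (x : V) :
    compSL g x 0 = x 0 * g 0 0 ^ 2 + x 1 * g 0 0 * g 1 0 + x 2 * g 1 0 ^ 2 := rfl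

/-- `(x ∘ g)₁ = 2x₀ab + x₁(ad + bc) + 2x₂cd`. [folklore] -/
@[simp] theorem compSL_apply_one (g : SL(2, ℝ)) (x : V) :
    compSL g x 1 = 2 * x 0 * g 0 0 * g 0 1 + x 1 * (g 0 0 * g 1 1 + g 0 1 * g 1 0) +
      2 * x 2 * g 1 0 * g 1 1 := rfl

/-- `(x ∘ g)₂ = x₀b² + x₁bd + x₂d²`. [folklore] -/
@[simp] theorem compSL_apply_two (g : SL(2, ℝ)) (x : V) :
    compSL g x 2 = x 0 * g 0 1 ^ 2 + x 1 * g 0 1 * g 1 1 + x 2 * g 1 1 ^ 2 := rfl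

/-- **The discriminant is invariant**: `disc (x ∘ g) = disc x`. [cite: Shintani1975, §2] -/
theorem disc_compSL (g : SL(2, ℝ)) (x : V) : disc (compSL g x) = disc x := by
  have h : g 0 0 * g 1 1 - g 0 1 * g 1 0 = 1 := by
    have hd := g.det_coe; rw [Matrix.det_fin_two] at hd; linear_combination hd
  simp only [disc, compSL_apply_zero, compSL_apply_one, compSL_apply_two]
  linear_combination (x 1 ^ 2 - 4 * x 0 * x 2) * (g 0 0 * g 1 1 - g 0 1 * g 1 0 + 1) * h

/-- **Evaluation transforms with weight `-2`**: `(x ∘ g)(w, 1) = (cw + d)² · x((aw+b)/(cw+d), 1)`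
for `cw + d ≠ 0`. [cite: Shintani1975, (2.12)] -/
theorem formEval_compSL_of_ne_zero (g : SL(2, ℝ)) (x : V) {w : ℂ}
    (hw : (g 1 0 : ℂ) * w + g 1 1 ≠ 0) :
    formEval (compSL g x) w =
      ((g 1 0 : ℂ) * w + g 1 1) ^ 2 * formEval x (((g 0 0 : ℂ) * w + g 0 1) / ((g 1 0 : ℂ) * w + g 1 1)) := by
  simp only [formEval, compSL_apply_zero, compSL_apply_one, compSL_apply_two]
  push_cast
  field_simp
  ring

/-- `cτ + d ≠ 0` for `τ ∈ ℍ` and `g ∈ SL₂(ℝ)`. [folklore] -/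
theorem denom_ne_zero' (g : SL(2, ℝ)) (τ : ℍ) : (g 1 0 : ℂ) * τ + g 1 1 ≠ 0 := by
  intro h
  have him : ((g 1 0 : ℂ) * τ + g 1 1).im = 0 := by rw [h]; rfl
  have hre : ((g 1 0 : ℂ) * τ + g 1 1).re = 0 := by rw [h]; rfl
  simp only [add_im, mul_im, ofReal_re, ofReal_im, zero_mul, add_zero, UpperHalfPlane.coe_im] at him
  rcases mul_eq_zero.mp him with hc | hτ
  · simp only [add_re, mul_re, ofReal_re, ofReal_im, zero_mul, sub_zero, hc, zero_add] at hre
    -- then `d = 0`, contradicting `ad - bc = 1`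
    have := (show g 0 0 * g 1 1 - g 0 1 * g 1 0 = 1 from by
      have hd := g.det_coe; rw [Matrix.det_fin_two] at hd; linear_combination hd)
    rw [hc, hre] at this
    simp at this
  · exact τ.im_ne_zero hτ

/-- `g·τ` in coordinates for `g ∈ SL₂(ℝ)`. [folklore] -/
theorem coe_sl_smul (g : SL(2, ℝ)) (τ : ℍ) :
    ((g • τ : ℍ) : ℂ) = ((g 0 0 : ℂ) * τ + g 0 1) / ((g 1 0 : ℂ) * τ + g 1 1) := by
  rw [UpperHalfPlane.coe_specialLinearGroup_apply]
  rfl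

/-- **`(x ∘ g)(τ, 1) = (cτ + d)² · x(g·τ, 1)`** on `ℍ`. [cite: Shintani1975, (2.12)] -/
theorem formEval_compSL (g : SL(2, ℝ)) (x : V) (τ : ℍ) :
    formEval (compSL g x) τ = ((g 1 0 : ℂ) * τ + g 1 1) ^ 2 * formEval x ((g • τ : ℍ) : ℂ) := by
  rw [coe_sl_smul, formEval_compSL_of_ne_zero g x (denom_ne_zero' g τ)]

/-- The algebra behind the transport of the majorant: with `p = aτ + b`, `q = cτ + d`,
`x₀|p|² + x₁ Re(p q̄) + x₂|q|² = (x∘g)₀ |τ|² + (x∘g)₁ Re τ + (x∘g)₂`. [folklore] -/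
theorem mixedValue_compSL (g : SL(2, ℝ)) (x : V) (τ : ℂ) :
    x 0 * normSq ((g 0 0 : ℂ) * τ + g 0 1) +
      x 1 * (((g 0 0 : ℂ) * τ + g 0 1) * (starRingEnd ℂ) ((g 1 0 : ℂ) * τ + g 1 1)).re +
      x 2 * normSq ((g 1 0 : ℂ) * τ + g 1 1) =
    compSL g x 0 * normSq τ + compSL g x 1 * τ.re + compSL g x 2 := by
  simp only [normSq_apply, mul_re, add_re, add_im, mul_im, ofReal_re, ofReal_im, conj_re, conj_im,
    compSL_apply_zero, compSL_apply_one, compSL_apply_two]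
  ring

/-- **The majorant is transported**: `p_τ(x ∘ g) = p_{g·τ}(x)`. [cite: Shintani1975, §2, (2.12)] -/
theorem pw_compSL (g : SL(2, ℝ)) (x : V) (τ : ℍ) : pw τ (compSL g x) = pw (g • τ) x := by
  have hq := denom_ne_zero' g τ
  have hnq : normSq ((g 1 0 : ℂ) * τ + g 1 1) ≠ 0 := (normSq_pos.mpr hq).ne'
  have hτ : (τ : ℂ).im ≠ 0 := by rw [UpperHalfPlane.coe_im]; exact τ.im_ne_zero
  set p : ℂ := (g 0 0 : ℂ) * τ + g 0 1 with hp
  set q : ℂ := (g 1 0 : ℂ) * τ + g 1 1 with hq'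
  have hcoe : ((g • τ : ℍ) : ℂ) = p / q := coe_sl_smul g τ
  have hre : ((g • τ : ℍ) : ℂ).re = (p * (starRingEnd ℂ) q).re / normSq q := by
    rw [hcoe, div_re, mul_re, conj_re, conj_im]
    field_simp
    ring
  have hnormSq : normSq ((g • τ : ℍ) : ℂ) = normSq p / normSq q := by
    rw [hcoe, normSq_div]
  have hdet : (p * (starRingEnd ℂ) q).im = (τ : ℂ).im := by
    have h1 : g 0 0 * g 1 1 - g 0 1 * g 1 0 = 1 := by
      have hd := g.det_coe; rw [Matrix.det_fin_two] at hd; linear_combination hd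
    simp only [hp, hq', mul_im, add_re, add_im, mul_re, ofReal_re, ofReal_im, conj_re, conj_im,
      zero_mul, sub_zero, add_zero]
    linear_combination (τ : ℂ).im * h1
  have him : ((g • τ : ℍ) : ℂ).im = (τ : ℂ).im / normSq q := by
    rw [hcoe, div_im]
    have : p.im * q.re - p.re * q.im = (p * (starRingEnd ℂ) q).im := by
      rw [mul_im, conj_re, conj_im]; ring
    rw [div_sub_div_same, this, hdet]
  rw [pw, pw, ← UpperHalfPlane.coe_re, ← UpperHalfPlane.coe_im, ← UpperHalfPlane.coe_re,
    ← UpperHalfPlane.coe_im, hnormSq, hre, him, ← mixedValue_compSL, ← hp, ← hq']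
  field_simp

/-- **`q_τ⁺(x ∘ g) = q_{g·τ}⁺(x)`**. [cite: Shintani1975, §2, (2.12)] -/
theorem majorant_compSL (g : SL(2, ℝ)) (x : V) (τ : ℍ) :
    majorant τ (compSL g x) = majorant (g • τ) x := by
  rw [majorant, majorant, disc_compSL, pw_compSL]

/-- **Equivariance of Shintani's Schwartz function under `SL₂(ℝ)`**:
`f_{τ,z}(x ∘ g) = (cτ + d)² · f_{g·τ,z}(x)`. [cite: Shintani1975, (2.12)] -/
theorem shintaniFn_compSL (g : SL(2, ℝ)) (x : V) (τ z : ℍ) :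
    shintaniFn τ z (compSL g x) = ((g 1 0 : ℂ) * τ + g 1 1) ^ 2 * shintaniFn (g • τ) z x := by
  rw [shintaniFn, shintaniFn, formEval_compSL, disc_compSL, majorant_compSL]
  ring

/-- `x ∘ 1 = x`. [folklore] -/
theorem compSL_one (x : V) : compSL 1 x = x := by
  ext i
  fin_cases i <;> simp [compSL]

/-- **Right action**: `x ∘ (g h) = (x ∘ g) ∘ h`. [folklore] -/
theorem compSL_mul (g h : SL(2, ℝ)) (x : V) : compSL (g * h) x = compSL h (compSL g x) := by
  ext i
  fin_cases i <;>
    simp [compSL, Matrix.SpecialLinearGroup.coe_mul, Matrix.mul_apply, Fin.sum_univ_two] <;> ring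

end Literature.NumberTheory.EllipticCurves.Shintani

end
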